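import Summits.ResolutionOfSingularities.ResolutionOfSingularities.Theorems.FrobeniusLadderFRationalResolutionBlowupRegularCompletionAscent
import Summits.ResolutionOfSingularities.ResolutionOfSingularities.Theorems.FrobeniusLadderFRationalResolutionGaloisBaseChangeRegular
import Literature.AlgebraicGeometry.Resolution.RegularHomRegularLocus
import Literature.AlgebraicGeometry.Resolution.ArtinApproximationAffineLemmas
import Literature.AlgebraicGeometry.Resolution.BlowupsFlatBaseChange
import HarnessLib

/-!
# Crux `FrobeniusLadder.FRationalResolution` (stmt-ResolutionOfSingularities-15317), line `redirect`,
# stub `stub_diagonalizableQuotientResolution` — HYGIENE LEMMAS OF THE INTRINSIC RECIPE: singular points of `Bl_J(Spec R)` lie over `V(J)`,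
# and `Spec Ê ∖ V(𝔪̂)` is regular for the complete local ring of the Galois route (MEMO-15317-leafhand2-g17 §3 «hygiene hypotheses»)

The packaging theorems of this generation (`…PointCentreBlowupRegular.exists_characteristic_ideal_isRegular_of_singularPoints`,
`…MaximalIdealTower.hloc_of_maximalIdealPow_then_singularPoints`) carry the hypothesis `hZ𝔪`: every singular point of `X₁ = Bl_{J₁}(Spec R)`
lies over `V(𝔪)`. Here it is discharged from «`Spec R` is regular off `V(J₁)`» (the blowing up is an isomorphism off `V(J₁)`), and the
latter is established for `R = Ê = ((B ⊗_K K')_{𝔔'})^` from the Galois route's standing hypothesis `hregB` (`Spec B` regular off `𝔭`):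
smooth ascent to `B ⊗_K K'` (tree `…GaloisBaseChangeRegular.mem_regularLocus_baseChange`), then ascent along the REGULAR homomorphism
`B ⊗_K K' → Ê` (G-ring, tree `IsGRing.isRegularHom_comp_completion` + `IsRegularHom.isRegularLocalRing_localization_iff`, Matsumura 23.7 (ii)).

* `mem_regularLocus_Spec_iff` — `x ∈ Reg(Spec N) ↔ N_x` regular (stalk = localization);
* `mem_regularLocus_affineBlowup_of_not_le` — off `V(J)` the blowing up has the regularity of the base (no openness hypotheses, compare
  `…BlowupRegularOffCentre`); `le_of_not_mem_regularLocus` — **singular points of `Bl_J` lie over `V(J)`** when `Spec R ∖ V(J)` is regular;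
  `le_of_not_mem_regularLocus_of_pow_le` — over `V(𝔪)` when `𝔪ⁿ ⊆ J`;
* ★ `mem_regularLocus_Spec_adicCompletion_of_not_le` — `B` of finite type over a field, `𝔮` maximal, `Spec B` regular at the primes `⊊ 𝔮`:
  **`Spec (B_𝔮)^` is regular off `V(𝔮 (B_𝔮)^)`**;
* ★★ `mem_regularLocus_Spec_adicCompletion_galois` — the same for `Ê = ((B ⊗_K K')_{𝔔'})^` from `hregB` (the Galois route's data);
  `hZ𝔪_of_galois` — the hypothesis `hZ𝔪` of `…MaximalIdealTower.hloc_of_maximalIdealPow_then_singularPoints`, discharged.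

Honest label: plumbing toward ONE leaf stub (no stub, crux or summit closed). No definitions, no named facts, no sorry.
[cite: Matsumura1987, Thm. 23.7; §32 p. 256] [cite: StacksProject, Tag 02OS; Tag 00GP] [cite: Grothendieck1967, Prop. 17.5.8 (iii)]
-/

noncomputable section

-- single-problem summit: the doubled namespace component is forced
set_option linter.dupNamespace false

open CategoryTheory CategoryTheory.Limits AlgebraicGeometry TopologicalSpace TensorProduct IsLocalRing
open Literature.AlgebraicGeometry.Resolution
open Summit.ResolutionOfSingularities.ResolutionOfSingularities.Theorems.FRationalResolution

namespace Summit.ResolutionOfSingularities.ResolutionOfSingularities.Theorems.FRationalResolution.SingularPointsOverVertex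

/-! ## §1 Regular locus of an affine scheme -/

/-- `𝒪_{Spec N, x} ≅ N_x`: a point of `Spec N` is regular iff `N_x` is a regular local ring. [folklore] -/
theorem mem_regularLocus_Spec_iff {N : Type} [CommRing N] (x : Spec (.of N)) :
    x ∈ Scheme.regularLocus (Spec (.of N)) ↔ IsRegularLocalRing (Localization.AtPrime x.asIdeal) := by
  letI : Algebra N ((Spec (.of N)).presheaf.stalk x) := (StructureSheaf.toStalk N x).hom.toAlgebra
  have hloc : IsLocalization.AtPrime ((Spec (.of N)).presheaf.stalk x) x.asIdeal :=
    StructureSheaf.IsLocalization.to_stalk N x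
  let e := (IsLocalization.algEquiv x.asIdeal.primeCompl ((Spec (.of N)).presheaf.stalk x)
    (Localization.AtPrime x.asIdeal)).toRingEquiv
  rw [Scheme.mem_regularLocus]
  exact ⟨fun h => IsRegularLocalRing.of_ringEquiv e, fun h => IsRegularLocalRing.of_ringEquiv e.symm⟩

/-! ## §2 Singular points of a blowing up lie over the centre -/

/-- **Off the centre the blowing up has the regularity of the base**: if `J ⊄ π(y)` and `π(y)` is a regular point of `Spec R`, then `y` is a
regular point of `Bl_J(Spec R)` (`π` is an isomorphism over `⋃_{a ∈ J} D(a)`). [cite: StacksProject, Tag 02OS] -/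
theorem mem_regularLocus_affineBlowup_of_not_le {R : Type} [CommRing R] (J : Ideal R) (y : affineBlowup J)
    (hJ : ¬ J ≤ (affineBlowup.π J y).asIdeal) (hreg : affineBlowup.π J y ∈ Scheme.regularLocus (Spec (.of R))) :
    y ∈ Scheme.regularLocus (affineBlowup J) := by
  set π := affineBlowup.π J with hπ
  set W : (Spec (.of R)).Opens := ⨆ a : J, (PrimeSpectrum.basicOpen (a : R) : (Spec (.of R)).Opens) with hW
  have hyW : π y ∈ W := by
    obtain ⟨a, haJ, hay⟩ := SetLike.not_le_iff_exists.mp hJ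
    exact Opens.mem_iSup.mpr ⟨⟨a, haJ⟩, (PrimeSpectrum.mem_basicOpen _ _).mpr hay⟩
  have hyW' : y ∈ π ⁻¹ᵁ W := hyW
  haveI : IsIso (π ∣_ W) := affineBlowup.isIso_morphismRestrict_iSup (I := J)
  -- through the open piece `π⁻¹ W ≅ W ↪ Spec R`
  let y' : (π ⁻¹ᵁ W : (affineBlowup J).Opens) := ⟨y, hyW'⟩
  have h1 : y' ∈ Scheme.regularLocus (π ⁻¹ᵁ W : (affineBlowup J).Opens) ↔ y ∈ Scheme.regularLocus (affineBlowup J) :=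
    mem_regularLocus_iff_of_flat_of_isPreimmersion (π ⁻¹ᵁ W).ι y'
  have h2 : y' ∈ Scheme.regularLocus (π ⁻¹ᵁ W : (affineBlowup J).Opens) ↔
      ((π ∣_ W) ≫ W.ι) y' ∈ Scheme.regularLocus (Spec (.of R)) :=
    mem_regularLocus_iff_of_flat_of_isPreimmersion ((π ∣_ W) ≫ W.ι) y'
  have h3 : ((π ∣_ W) ≫ W.ι) y' = π y := by
    rw [morphismRestrict_ι]
    rfl
  exact h1.mp (h2.mpr (h3 ▸ hreg))

/-- **Singular points of `Bl_J(Spec R)` lie over `V(J)`** when `Spec R` is regular off `V(J)`. [cite: StacksProject, Tag 02OS] -/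
theorem le_of_not_mem_regularLocus {R : Type} [CommRing R] (J : Ideal R)
    (hRegJ : ∀ P : Spec (.of R), ¬ J ≤ P.asIdeal → P ∈ Scheme.regularLocus (Spec (.of R)))
    (y : affineBlowup J) (hy : y ∉ Scheme.regularLocus (affineBlowup J)) : J ≤ (affineBlowup.π J y).asIdeal := by
  by_contra h
  exact hy (mem_regularLocus_affineBlowup_of_not_le J y h (hRegJ _ h))

/-- The same with `𝔪ⁿ ⊆ J ⊆ 𝔪`: singular points of `Bl_J(Spec R)` lie over `V(𝔪)` when `Spec R` is regular off `V(𝔪)`. [folklore] -/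
theorem le_of_not_mem_regularLocus_of_pow_le {R : Type} [CommRing R] (𝔪 J : Ideal R) {n : ℕ} (hn : 𝔪 ^ n ≤ J) (hJ𝔪 : J ≤ 𝔪)
    (hReg : ∀ P : Spec (.of R), ¬ 𝔪 ≤ P.asIdeal → P ∈ Scheme.regularLocus (Spec (.of R))) :
    ∀ z ∈ (Scheme.regularLocus (affineBlowup J))ᶜ, 𝔪 ≤ (affineBlowup.π J z).asIdeal := by
  intro z hz
  have hJ : J ≤ (affineBlowup.π J z).asIdeal :=
    le_of_not_mem_regularLocus J (fun P hP => hReg P fun h𝔪 => hP (hJ𝔪.trans h𝔪)) z hz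
  exact (affineBlowup.π J z).2.le_of_pow_le (hn.trans hJ)

/-! ## §3 The complete local ring is regular off the vertex -/

/-- ★ **`Spec (B_𝔮)^` is regular off `V(𝔮(B_𝔮)^)`** for `B` of finite type over a field (a G-ring), `𝔮` maximal and `Spec B` regular at every
prime `⊊ 𝔮`: the composite `B → B_𝔮 → (B_𝔮)^` is a regular homomorphism, and regularity ascends along it prime by prime (Matsumura 23.7 (ii)).
[cite: Matsumura1987, Thm. 23.7 (ii); §32 p. 256] -/
theorem mem_regularLocus_Spec_adicCompletion_of_not_le (K : Type) [Field K] {B : Type} [CommRing B] [Algebra K B]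
    [Algebra.FiniteType K B] (𝔮 : Ideal B) [𝔮.IsMaximal]
    (hoff : ∀ x : Spec (.of B), x.asIdeal ≤ 𝔮 → x.asIdeal ≠ 𝔮 → x ∈ Scheme.regularLocus (Spec (.of B)))
    (Q : Spec (.of (AdicCompletion (maximalIdeal (Localization.AtPrime 𝔮)) (Localization.AtPrime 𝔮))))
    (hQ : ¬ 𝔮.map (algebraMap B (AdicCompletion (maximalIdeal (Localization.AtPrime 𝔮)) (Localization.AtPrime 𝔮))) ≤ Q.asIdeal) :
    Q ∈ Scheme.regularLocus (Spec (.of (AdicCompletion (maximalIdeal (Localization.AtPrime 𝔮)) (Localization.AtPrime 𝔮)))) := by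
  have hB : IsGRing B := Matsumura1987_32_6_cor_holds.{0} K B ‹_›
  haveI : IsNoetherianRing B := hB.1
  haveI : IsNoetherianRing (Localization.AtPrime 𝔮) :=
    IsLocalization.isNoetherianRing 𝔮.primeCompl (Localization.AtPrime 𝔮) inferInstance
  set Ê := AdicCompletion (maximalIdeal (Localization.AtPrime 𝔮)) (Localization.AtPrime 𝔮) with hÊ
  haveI : IsNoetherianRing Ê := isNoetherianRing_adicCompletion_maximalIdeal _
  have hfac : algebraMap B Ê = (algebraMap (Localization.AtPrime 𝔮) Ê).comp (algebraMap B (Localization.AtPrime 𝔮)) :=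
    RingHom.ext fun _ => rfl
  have h : IsRegularHom B Ê := IsGRing.isRegularHom_comp_completion hB 𝔮 (Localization.AtPrime 𝔮)
  -- the prime below `Q` in `B` is `⊊ 𝔮`
  set q : Ideal B := Q.asIdeal.under B with hq
  have hq1 : q ≤ 𝔮 := by
    have h1 : (Q.asIdeal.under (Localization.AtPrime 𝔮)) ≤ maximalIdeal (Localization.AtPrime 𝔮) :=
      IsLocalRing.le_maximalIdeal (Ideal.IsPrime.ne_top inferInstance)
    have h2 : q = (Q.asIdeal.under (Localization.AtPrime 𝔮)).under B := by
      rw [hq, Ideal.under_under]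
    have h3 : ((Q.asIdeal.under (Localization.AtPrime 𝔮)).under B) ≤ (maximalIdeal (Localization.AtPrime 𝔮)).under B :=
      Ideal.comap_mono h1
    have h4 : (maximalIdeal (Localization.AtPrime 𝔮)).under B = 𝔮 :=
      IsLocalization.AtPrime.under_maximalIdeal (Localization.AtPrime 𝔮) 𝔮
    calc q = (Q.asIdeal.under (Localization.AtPrime 𝔮)).under B := h2
      _ ≤ (maximalIdeal (Localization.AtPrime 𝔮)).under B := h3
      _ = 𝔮 := h4
  have hq2 : q ≠ 𝔮 := by
    intro hq𝔮
    apply hQ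
    rw [Ideal.map_le_iff_le_comap]
    intro x hx
    rw [← hq𝔮] at hx
    exact hx
  have hreg : IsRegularLocalRing (Localization.AtPrime q) := (mem_regularLocus_Spec_iff ⟨q, inferInstance⟩).mp (hoff _ hq1 hq2)
  exact (mem_regularLocus_Spec_iff Q).mpr ((h.isRegularLocalRing_localization_iff Q.asIdeal).mpr hreg)

/-! ## §4 In the Galois route's data -/

/-- ★★ **`Spec Ê ∖ V(𝔪̂)` is regular for `Ê = ((B ⊗_K K')_{𝔔'})^`** from the Galois route's hypothesis `hregB` (`Spec B` regular off the
maximal `𝔭`; that `𝔔'` lies over `𝔭` is not even needed): the primes `⊊ 𝔔'` of `B ⊗_K K'` lie over primes `≠ 𝔭` (the primes over the maximal `𝔭` are maximal, `B ⊗_K K'` being integral over `B`), which are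
regular, so they are regular (smooth ascent), and §3 applies. [cite: Grothendieck1967, Prop. 17.5.8 (iii)] [cite: Matsumura1987, Thm. 23.7 (ii)] -/
theorem mem_regularLocus_Spec_adicCompletion_galois (K : Type) [Field K] {B : Type} [CommRing B] [Algebra K B]
    [Algebra.FiniteType K B] (𝔭 : Ideal B) [h𝔭 : 𝔭.IsMaximal]
    (hregB : ∀ P : Spec (.of B), P.asIdeal ≠ 𝔭 → P ∈ Scheme.regularLocus (Spec (.of B)))
    (K' : Type) [Field K'] [Algebra K K'] [FiniteDimensional K K'] [IsGalois K K']
    (𝔔' : Ideal (B ⊗[K] K')) [h𝔔' : 𝔔'.IsMaximal]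
    (Q : Spec (.of (AdicCompletion (maximalIdeal (Localization.AtPrime 𝔔')) (Localization.AtPrime 𝔔'))))
    (hQ : ¬ 𝔔'.map (algebraMap (B ⊗[K] K') (AdicCompletion (maximalIdeal (Localization.AtPrime 𝔔')) (Localization.AtPrime 𝔔'))) ≤
      Q.asIdeal) :
    Q ∈ Scheme.regularLocus (Spec (.of (AdicCompletion (maximalIdeal (Localization.AtPrime 𝔔')) (Localization.AtPrime 𝔔')))) := by
  haveI : IsNoetherianRing B := Algebra.FiniteType.isNoetherianRing K B
  haveI : Algebra.FiniteType B (B ⊗[K] K') := inferInstance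
  haveI : Algebra.FiniteType K (B ⊗[K] K') := Algebra.FiniteType.trans (S := B) inferInstance inferInstance
  refine mem_regularLocus_Spec_adicCompletion_of_not_le K 𝔔' (fun x hx hx' => ?_) Q hQ
  refine GaloisBaseChangeRegular.mem_regularLocus_baseChange K K' B x (hregB _ fun hx𝔭 => hx' ?_)
  -- a prime `x ⊆ 𝔔'` over the maximal `𝔭` is maximal, hence `= 𝔔'`
  change x.asIdeal.comap (algebraMap B (B ⊗[K] K')) = 𝔭 at hx𝔭
  haveI : (x.asIdeal.comap (algebraMap B (B ⊗[K] K'))).IsMaximal := by rw [hx𝔭]; exact h𝔭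
  haveI : x.asIdeal.IsMaximal := Ideal.isMaximal_of_isIntegral_of_isMaximal_comap (R := B) x.asIdeal inferInstance
  exact (Ideal.IsMaximal.eq_of_le inferInstance h𝔔'.ne_top hx)

/-- **The hypothesis `hZ𝔪` of `…MaximalIdealTower.hloc_of_maximalIdealPow_then_singularPoints` / `…PointCentreBlowupRegular.…_of_singularPoints`,
discharged in the Galois route's data**: singular points of `Bl_J(Spec Ê)`, `(𝔔'Ê)ⁿ ⊆ J ⊆ 𝔔'Ê`, lie over `V(𝔔'Ê)`. [folklore] -/
theorem hZ𝔪_of_galois (K : Type) [Field K] {B : Type} [CommRing B] [Algebra K B]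
    [Algebra.FiniteType K B] (𝔭 : Ideal B) [h𝔭 : 𝔭.IsMaximal]
    (hregB : ∀ P : Spec (.of B), P.asIdeal ≠ 𝔭 → P ∈ Scheme.regularLocus (Spec (.of B)))
    (K' : Type) [Field K'] [Algebra K K'] [FiniteDimensional K K'] [IsGalois K K']
    (𝔔' : Ideal (B ⊗[K] K')) [h𝔔' : 𝔔'.IsMaximal]
    (J : Ideal (AdicCompletion (maximalIdeal (Localization.AtPrime 𝔔')) (Localization.AtPrime 𝔔'))) {n : ℕ}
    (hn : 𝔔'.map (algebraMap (B ⊗[K] K') (AdicCompletion (maximalIdeal (Localization.AtPrime 𝔔')) (Localization.AtPrime 𝔔'))) ^ n ≤ J)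
    (hJ : J ≤ 𝔔'.map (algebraMap (B ⊗[K] K') (AdicCompletion (maximalIdeal (Localization.AtPrime 𝔔')) (Localization.AtPrime 𝔔')))) :
    ∀ z ∈ (Scheme.regularLocus (affineBlowup J))ᶜ,
      𝔔'.map (algebraMap (B ⊗[K] K') (AdicCompletion (maximalIdeal (Localization.AtPrime 𝔔')) (Localization.AtPrime 𝔔'))) ≤
        (affineBlowup.π J z).asIdeal :=
  le_of_not_mem_regularLocus_of_pow_le _ J hn hJ fun P hP =>
    mem_regularLocus_Spec_adicCompletion_galois K 𝔭 hregB K' 𝔔' P hP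

end Summit.ResolutionOfSingularities.ResolutionOfSingularities.Theorems.FRationalResolution.SingularPointsOverVertex

end
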